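import Literature.AlgebraicGeometry.Motives.HodgeThetaSubalgebraUnitaryFiveCoreAll
import HarnessLib

/-!
# The `Θ`-subalgebra theorem for unitary multiplicities `(6, b)`, `gcd(b, 6) = 1`, and `(7, b)`, `7 ∤ b` — complex
# Hermitian cores (Ribet 1983, Thm. 3 at `n′ = 6, 7` and EVERY coprime `n″`: e.g. `17 = 6 + 11 = 7 + 10`, `19 = 6 + 13 = 7 + 12`)

Family `hodge`, layer `Literature/AlgebraicGeometry/Motives` (pure linear algebra over `ℂ`; no geometry). Research
context: cell `pub-hodge-ring2` (HONEST FRAMING: research route conditional on HC_CM; not a corollary; Q11.4-sentence-2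
already refuted in dim ≥ 3), Literature lane gen 84, programme R67. UNCONDITIONAL; theorems only, no definition, no
named fact (D-0026), no `sorry`. With the TRIPLE ROUTE (`HodgeThetaSubalgebraUnitaryRaisingRankTriple`: at maximal
rank `r = dim P − 1` the rank identity `m (r + 1 − ρ) = r ρ`, `1 ≤ ρ < r`, must hold) the last rank step `a − 1 → a` of
the raising lemma is free for `a = 6` (`m (6 − ρ) = 5 ρ` forces `m ∈ {1, 5, 10}`, i.e. `dim Q ∈ {6, 10, 15}`, never
prime to `6`) and for `a = 7` (`m (7 − ρ) = 6 ρ` forces `m ∈ {1, 8, 15}`, i.e. `7 ∣ dim Q`); the lower rank steps use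
the tree's Φ-route (`a = 6`: cores `(2 | odd)`, `(3 | ·)`, `(4 | odd)`) resp. Ψ-core route (`a = 7`: cores `(5 | 2)`,
`(4 | 3)`, `(3 | 4)`, `(2 | 5)`, all in the tree); the Levi recursions `b → b − 6`, `b → b − 7` end at the tree's cores
`(6 | 1)`, `(6 | 5)` (= `UnitaryFive.eq_top_of_smul'`), `(6 | 7)` resp. `(7 | 1, 2, 3, 4, 5, 6)`. As for `(5 | b)`, the
Hermitian form is assumed `ℂ`-homogeneous in the first slot (true in the sockets).

* §1 `UnitarySix.exists_raise_onto_six_of_smul`, **`UnitarySix.eq_top_of_smul`**, `eq_top_of_smul'` — `(6 | b)` for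
  every odd `b` with `3 ∤ b`.
* §2 `UnitarySeven.exists_raise_onto_seven_of_smul`, **`UnitarySeven.eq_top_of_smul`**, `eq_top_of_smul'` — `(7 | b)`
  for every `b` with `7 ∤ b`.

## References
* [Ribet1983] K. A. Ribet, Amer. J. Math. 105 (1983), Thm. 3.
* [Gordon1997] B. B. Gordon, *A survey of the Hodge conjecture for abelian varieties*, Thm. 6.3 (3), pp. 18–19.
* [Deligne1982HodgeCycles] P. Deligne, LNM 900 (1982), I §3 Prop. 3.4, 3.6.
-/

noncomputable section

namespace Literature.AlgebraicGeometry.Motives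

namespace HodgeStructure

/-! ### §1 Multiplicities `(6, b)`, `gcd(b, 6) = 1` -/

section RankSix

universe u

variable {W : Type u} [AddCommGroup W] [Module ℂ W]

/-- **The rank-six raising lemma** (`dim P = 6`, `dim Q ≥ 7` odd and prime to `3`; the Hermitian form `ℂ`-homogeneous
in the first slot): ranks `2, 3, 4 → +1` by the Φ-route with the cores `(2 | odd)`, `(3 | ·)`, `(4 | odd)`, rank `5 → 6`
by the triple route. [cite: Ribet1983, Thm. 3] [cite: Gordon1997, Thm. 6.3 (3)] [cite: Deligne1982HodgeCycles, I §3 Prop. 3.6] -/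
theorem UnitarySix.exists_raise_onto_six_of_smul [FiniteDimensional ℂ W] {𝔊 : Submodule ℂ (Module.End ℂ W)}
    (hbr : ∀ Y ∈ 𝔊, ∀ Z ∈ 𝔊, Y * Z - Z * Y ∈ 𝔊)
    (hirr : ∀ U : Submodule ℂ W, (∀ A ∈ 𝔊, ∀ u ∈ U, A u ∈ U) → U = ⊥ ∨ U = ⊤)
    {Θ : Module.End ℂ W} (hΘ : Θ ∈ 𝔊) (hΘΘ : Θ * Θ = 1)
    {P Q : Submodule ℂ W} (hP : ∀ x, x ∈ P ↔ Θ x = x) (hQ : ∀ x, x ∈ Q ↔ Θ x = -x)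
    (hP6 : Module.finrank ℂ P = 6) (hQ7 : 7 ≤ Module.finrank ℂ Q) (hQodd : Odd (Module.finrank ℂ Q))
    (hQ3 : ¬ 3 ∣ Module.finrank ℂ Q)
    {s : W → W → ℂ} (hadd : ∀ x y z, s (x + y) z = s x z + s y z)
    (hsmul : ∀ (c : ℂ) (x y : W), s (c • x) y = c * s x y) (hsymm : ∀ x y, s y x = starRingEnd ℂ (s x y))
    (hPQ : ∀ p ∈ P, ∀ q ∈ Q, s p q = 0) (hdefP : ∀ p ∈ P, s p p = 0 → p = 0) (hdefQ : ∀ q ∈ Q, s q q = 0 → q = 0)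
    (hadj : ∀ X ∈ 𝔊, ∃ Y ∈ 𝔊, ∀ x y, s (X x) y = s x (Y y)) :
    ∃ B ∈ 𝔊, Θ * B = B ∧ B * Θ = -B ∧ ∀ p ∈ P, ∃ w, B w = p := by
  classical
  obtain ⟨k, hk⟩ := hQodd
  have hraiseval : ∀ Z : Module.End ℂ W, Θ * Z = Z → ∀ w, Z w ∈ P := fun Z hΘZ w =>
    (hP _).2 (by rw [← Module.End.mul_apply, hΘZ])
  have hle : ∀ B' : Module.End ℂ W, Θ * B' = B' → Module.finrank ℂ (LinearMap.range B') ≤ 6 := fun B' h => by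
    rw [← hP6]
    exact Submodule.finrank_mono (by rintro _ ⟨w, rfl⟩; exact hraiseval B' h w)
  have honto : ∀ B' : Module.End ℂ W, Θ * B' = B' → 6 ≤ Module.finrank ℂ (LinearMap.range B') →
      ∀ p ∈ P, ∃ w, B' w = p := by
    intro B' hΘB' h6 p hp
    have hle' : LinearMap.range B' ≤ P := by rintro _ ⟨w, rfl⟩; exact hraiseval B' hΘB' w
    have heq : LinearMap.range B' = P := Submodule.eq_of_le_of_finrank_le hle' (by rw [hP6]; exact h6)
    have hp' : p ∈ LinearMap.range B' := heq ▸ hp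
    exact hp'
  have hup : ∀ B' ∈ 𝔊, Θ * B' = B' → B' * Θ = -B' →
      2 ≤ Module.finrank ℂ (LinearMap.range B') → Module.finrank ℂ (LinearMap.range B') ≤ 5 →
      ∃ B'' ∈ 𝔊, Θ * B'' = B'' ∧ B'' * Θ = -B'' ∧
        Module.finrank ℂ (LinearMap.range B') < Module.finrank ℂ (LinearMap.range B'') := by
    intro B' hB' hΘB' hB'Θ h2 h5
    by_cases hr5 : Module.finrank ℂ (LinearMap.range B') = 5
    · -- triple route: `m (6 − ρ) = 5 ρ` forces `dim Q ∈ {6, 10, 15}`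
      refine UnitaryRaisingRank.exists_raise_rank_gt_of_finrank_eq_succ_of_smul hbr hirr hΘ hΘΘ hP hQ hB' hΘB' hB'Θ
        (by omega) (by rw [hr5, hP6]) (by omega) (fun ρ hρ1 hρr => ?_) hadd hsmul hsymm hPQ hdefP hdefQ hadj
      rw [hr5] at hρr ⊢
      interval_cases ρ <;> omega
    · -- Φ-route with the cores `(2 | odd)`, `(3 | ·)`, `(4 | odd)`
      refine UnitaryRaisingRank.exists_raise_rank_gt_of_two_le hbr hirr hΘ hΘΘ hP hQ hadd hsymm hPQ hdefP hdefQ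
        hadj hB' hΘB' hB'Θ (by omega) (by omega) (by omega) fun U 𝔩 ι P' Q' hbr𝔩 hirr𝔩 hι hιι hP' hQ' hfinP' hfinQ'
          hP'Q' hdefP' hdefQ' hadj𝔩 => ?_
      by_cases hr2 : Module.finrank ℂ (LinearMap.range B') = 2
      · exact UnitaryTwoOdd.eq_top hbr𝔩 hirr𝔩 hι hιι hP' hQ' (by rw [hfinP', hr2]) ⟨k - 1, by omega⟩
          (s := fun x y : U => s (x : W) y) (fun x y z => by simp only [Submodule.coe_add, hadd])
          (fun x y => hsymm x y) hP'Q' hdefP' hdefQ' hadj𝔩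
      by_cases hr3 : Module.finrank ℂ (LinearMap.range B') = 3
      · exact UnitaryThreeCoprime.eq_top hbr𝔩 hirr𝔩 hι hιι hP' hQ' (by rw [hfinP', hr3]) (by omega)
          (s := fun x y : U => s (x : W) y) (fun x y z => by simp only [Submodule.coe_add, hadd])
          (fun x y => hsymm x y) hP'Q' hdefP' hdefQ' hadj𝔩
      · have hr4 : Module.finrank ℂ (LinearMap.range B') = 4 := by omega
        exact UnitaryFourOdd.eq_top hbr𝔩 hirr𝔩 hι hιι hP' hQ' (by rw [hfinP', hr4]) ⟨k - 2, by omega⟩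
          (s := fun x y : U => s (x : W) y) (fun x y z => by simp only [Submodule.coe_add, hadd])
          (fun x y => hsymm x y) hP'Q' hdefP' hdefQ' hadj𝔩
  obtain ⟨B₂, hB₂, hΘB₂, hB₂Θ, hrk₂⟩ :=
    UnitaryThreeCoprime.exists_raise_rank_ge_two hbr hirr hΘ hΘΘ hP hQ (by omega) (by omega)
  have h₂ := hle B₂ hΘB₂
  by_cases h6 : 6 ≤ Module.finrank ℂ (LinearMap.range B₂)
  · exact ⟨B₂, hB₂, hΘB₂, hB₂Θ, honto B₂ hΘB₂ h6⟩
  obtain ⟨B₃, hB₃, hΘB₃, hB₃Θ, hrk₃⟩ := hup B₂ hB₂ hΘB₂ hB₂Θ hrk₂ (by omega)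
  have h₃ := hle B₃ hΘB₃
  by_cases h6' : 6 ≤ Module.finrank ℂ (LinearMap.range B₃)
  · exact ⟨B₃, hB₃, hΘB₃, hB₃Θ, honto B₃ hΘB₃ h6'⟩
  obtain ⟨B₄, hB₄, hΘB₄, hB₄Θ, hrk₄⟩ := hup B₃ hB₃ hΘB₃ hB₃Θ (by omega) (by omega)
  have h₄ := hle B₄ hΘB₄
  by_cases h6'' : 6 ≤ Module.finrank ℂ (LinearMap.range B₄)
  · exact ⟨B₄, hB₄, hΘB₄, hB₄Θ, honto B₄ hΘB₄ h6''⟩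
  obtain ⟨B₅, hB₅, hΘB₅, hB₅Θ, hrk₅⟩ := hup B₄ hB₄ hΘB₄ hB₄Θ (by omega) (by omega)
  have h₅ := hle B₅ hΘB₅
  by_cases h6''' : 6 ≤ Module.finrank ℂ (LinearMap.range B₅)
  · exact ⟨B₅, hB₅, hΘB₅, hB₅Θ, honto B₅ hΘB₅ h6'''⟩
  obtain ⟨B₆, hB₆, hΘB₆, hB₆Θ, hrk₆⟩ := hup B₅ hB₅ hΘB₅ hB₅Θ (by omega) (by omega)
  have h₆ := hle B₆ hΘB₆
  exact ⟨B₆, hB₆, hΘB₆, hB₆Θ, honto B₆ hΘB₆ (by omega)⟩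

end RankSix

section MainSix

variable {W : Type*} [AddCommGroup W] [Module ℂ W]

universe u in
/-- The induction behind `UnitarySix.eq_top_of_smul` (strong induction on odd `b` prime to `3`; bases `b = 1, 5, 7`; step
`b → b − 6` by `UnitaryCoprimeStep.eq_top_of_onto_of_core`). [cite: Ribet1983, Thm. 3]
[cite: Gordon1997, §6 (proof of Thm. 6.3.3, pp. 18–19)] -/
private theorem UnitarySix.eq_top_of_smul_aux (b : ℕ) :
    ∀ {W : Type u} [AddCommGroup W] [Module ℂ W] [FiniteDimensional ℂ W]
      {𝔊 : Submodule ℂ (Module.End ℂ W)},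
      (∀ Y ∈ 𝔊, ∀ Z ∈ 𝔊, Y * Z - Z * Y ∈ 𝔊) →
      (∀ U : Submodule ℂ W, (∀ A ∈ 𝔊, ∀ u ∈ U, A u ∈ U) → U = ⊥ ∨ U = ⊤) →
      ∀ {Θ : Module.End ℂ W}, Θ ∈ 𝔊 → Θ * Θ = 1 →
      ∀ {P Q : Submodule ℂ W}, (∀ x, x ∈ P ↔ Θ x = x) → (∀ x, x ∈ Q ↔ Θ x = -x) →
      Module.finrank ℂ P = 6 → Module.finrank ℂ Q = b → Odd b → ¬ 3 ∣ b →
      ∀ {s : W → W → ℂ}, (∀ x y z, s (x + y) z = s x z + s y z) →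
      (∀ (c : ℂ) (x y : W), s (c • x) y = c * s x y) →
      (∀ x y, s y x = starRingEnd ℂ (s x y)) →
      (∀ p ∈ P, ∀ q ∈ Q, s p q = 0) → (∀ p ∈ P, s p p = 0 → p = 0) → (∀ q ∈ Q, s q q = 0 → q = 0) →
      (∀ X ∈ 𝔊, ∃ Y ∈ 𝔊, ∀ x y, s (X x) y = s x (Y y)) → 𝔊 = ⊤ := by
  induction b using Nat.strong_induction_on with
  | _ b ih =>
  intro W _ _ _ 𝔊 hbr hirr Θ hΘ hΘΘ P Q hP hQ hP6 hQb hbodd hb3 s hadd hsmul hsymm hPQ hdefP hdefQ hadj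
  obtain ⟨k, hk⟩ := hbodd
  by_cases hb1 : b = 1
  · exact UnitaryThreeCoprime.eq_top_of_finrank_eq_one hbr hirr hΘ hΘΘ hP hQ (by omega) (by rw [hQb, hb1])
  by_cases hb5 : b = 5
  · exact UnitaryFive.eq_top_of_smul' hbr hirr hΘ hΘΘ hP hQ (by rw [hP6]; decide) (by rw [hQb, hb5]) hadd hsmul
      hsymm hPQ hdefP hdefQ hadj
  by_cases hb7 : b = 7
  · exact UnitaryCoprimeStep.eq_top_six_seven hbr hirr hΘ hΘΘ hP hQ hP6 (by rw [hQb, hb7]) hadd hsymm hPQ hdefP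
      hdefQ hadj
  have hb11 : 11 ≤ b := by omega
  refine UnitaryCoprimeStep.eq_top_of_onto_of_core hbr hirr hΘ hΘΘ hP hQ hP6 hQb (by norm_num) (by omega) hadd hsymm
    hPQ hdefP hdefQ hadj ?_ ?_
  · exact UnitarySix.exists_raise_onto_six_of_smul hbr hirr hΘ hΘΘ hP hQ hP6 (by rw [hQb]; omega)
      (by rw [hQb]; exact ⟨k, hk⟩) (by rw [hQb]; exact hb3) hadd hsmul hsymm hPQ hdefP hdefQ hadj
  · intro 𝔩 ι P' Q' hbr𝔩 hirr𝔩 hι hιι hP' hQ' hfinP' hfinQ' hP'Q' hdefP' hdefQ' hadj𝔩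
    exact ih (b - 6) (by omega) hbr𝔩 hirr𝔩 hι hιι hP' hQ' hfinP' hfinQ' ⟨k - 3, by omega⟩ (by omega)
      (s := fun x y : Q => s (x : W) y) (fun x y z => by simp only [Submodule.coe_add, hadd])
      (fun c x y => by simp only [Submodule.coe_smul, hsmul]) (fun x y => hsymm x y) hP'Q' hdefP' hdefQ' hadj𝔩

/-- **THE `Θ`-SUBALGEBRA THEOREM FOR UNITARY MULTIPLICITIES `(6, b)`, EVERY `b` PRIME TO `6`** (Ribet's Thm. 3 at
`(6, n″)`, `gcd(6, n″) = 1`, classification-free; NEW beyond the tree's `(6,7)`: `b = 11, 13, 17, 19, 23, 25, …`).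
[cite: Ribet1983, Thm. 3] [cite: Gordon1997, Thm. 6.3 (3) and pp. 18–19] [cite: Deligne1982HodgeCycles, I §3 Prop. 3.4, 3.6] -/
theorem UnitarySix.eq_top_of_smul [FiniteDimensional ℂ W] {𝔊 : Submodule ℂ (Module.End ℂ W)}
    (hbr : ∀ Y ∈ 𝔊, ∀ Z ∈ 𝔊, Y * Z - Z * Y ∈ 𝔊)
    (hirr : ∀ U : Submodule ℂ W, (∀ A ∈ 𝔊, ∀ u ∈ U, A u ∈ U) → U = ⊥ ∨ U = ⊤)
    {Θ : Module.End ℂ W} (hΘ : Θ ∈ 𝔊) (hΘΘ : Θ * Θ = 1)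
    {P Q : Submodule ℂ W} (hP : ∀ x, x ∈ P ↔ Θ x = x) (hQ : ∀ x, x ∈ Q ↔ Θ x = -x)
    (hP6 : Module.finrank ℂ P = 6) (hQodd : Odd (Module.finrank ℂ Q)) (hQ3 : ¬ 3 ∣ Module.finrank ℂ Q)
    {s : W → W → ℂ} (hadd : ∀ x y z, s (x + y) z = s x z + s y z)
    (hsmul : ∀ (c : ℂ) (x y : W), s (c • x) y = c * s x y) (hsymm : ∀ x y, s y x = starRingEnd ℂ (s x y))
    (hPQ : ∀ p ∈ P, ∀ q ∈ Q, s p q = 0) (hdefP : ∀ p ∈ P, s p p = 0 → p = 0) (hdefQ : ∀ q ∈ Q, s q q = 0 → q = 0)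
    (hadj : ∀ X ∈ 𝔊, ∃ Y ∈ 𝔊, ∀ x y, s (X x) y = s x (Y y)) : 𝔊 = ⊤ :=
  UnitarySix.eq_top_of_smul_aux _ hbr hirr hΘ hΘΘ hP hQ hP6 rfl hQodd hQ3 hadd hsmul hsymm hPQ hdefP hdefQ hadj

/-- **The mirror `(b | 6)`, `gcd(b, 6) = 1`** (apply `eq_top_of_smul` to `−Θ`). [cite: Ribet1983, Thm. 3]
[cite: Gordon1997, Thm. 6.3 (3)] -/
theorem UnitarySix.eq_top_of_smul' [FiniteDimensional ℂ W] {𝔊 : Submodule ℂ (Module.End ℂ W)}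
    (hbr : ∀ Y ∈ 𝔊, ∀ Z ∈ 𝔊, Y * Z - Z * Y ∈ 𝔊)
    (hirr : ∀ U : Submodule ℂ W, (∀ A ∈ 𝔊, ∀ u ∈ U, A u ∈ U) → U = ⊥ ∨ U = ⊤)
    {Θ : Module.End ℂ W} (hΘ : Θ ∈ 𝔊) (hΘΘ : Θ * Θ = 1)
    {P Q : Submodule ℂ W} (hP : ∀ x, x ∈ P ↔ Θ x = x) (hQ : ∀ x, x ∈ Q ↔ Θ x = -x)
    (hPodd : Odd (Module.finrank ℂ P)) (hP3 : ¬ 3 ∣ Module.finrank ℂ P) (hQ6 : Module.finrank ℂ Q = 6)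
    {s : W → W → ℂ} (hadd : ∀ x y z, s (x + y) z = s x z + s y z)
    (hsmul : ∀ (c : ℂ) (x y : W), s (c • x) y = c * s x y) (hsymm : ∀ x y, s y x = starRingEnd ℂ (s x y))
    (hPQ : ∀ p ∈ P, ∀ q ∈ Q, s p q = 0) (hdefP : ∀ p ∈ P, s p p = 0 → p = 0) (hdefQ : ∀ q ∈ Q, s q q = 0 → q = 0)
    (hadj : ∀ X ∈ 𝔊, ∃ Y ∈ 𝔊, ∀ x y, s (X x) y = s x (Y y)) : 𝔊 = ⊤ := by
  have hnΘ : -Θ ∈ 𝔊 := Submodule.neg_mem _ hΘ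
  have hnΘΘ : (-Θ) * (-Θ) = 1 := by rw [neg_mul_neg, hΘΘ]
  exact UnitarySix.eq_top_of_smul hbr hirr hnΘ hnΘΘ (P := Q) (Q := P)
    (fun x => by rw [hQ, LinearMap.neg_apply, neg_eq_iff_eq_neg]) (fun x => by rw [hP, LinearMap.neg_apply, neg_inj])
    hQ6 hPodd hP3 hadd hsmul hsymm (fun q hq p hp => by rw [hsymm, hPQ p hp q hq, map_zero]) hdefQ hdefP hadj

end MainSix

/-! ### §2 Multiplicities `(7, b)`, `7 ∤ b` -/

section RankSeven

universe u

variable {W : Type u} [AddCommGroup W] [Module ℂ W]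

/-- **The rank-seven raising lemma** (`dim P = 7`, `dim Q ≥ 8`, `7 ∤ dim Q`; the Hermitian form `ℂ`-homogeneous in the
first slot): ranks `2, 3, 4, 5 → +1` by the Ψ-core route with the cores `(5 | 2)`, `(4 | 3)`, `(3 | 4)`, `(2 | 5)`, rank
`6 → 7` by the triple route. [cite: Ribet1983, Thm. 3] [cite: Gordon1997, Thm. 6.3 (3)] [cite: Deligne1982HodgeCycles, I §3 Prop. 3.6] -/
theorem UnitarySeven.exists_raise_onto_seven_of_smul [FiniteDimensional ℂ W] {𝔊 : Submodule ℂ (Module.End ℂ W)}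
    (hbr : ∀ Y ∈ 𝔊, ∀ Z ∈ 𝔊, Y * Z - Z * Y ∈ 𝔊)
    (hirr : ∀ U : Submodule ℂ W, (∀ A ∈ 𝔊, ∀ u ∈ U, A u ∈ U) → U = ⊥ ∨ U = ⊤)
    {Θ : Module.End ℂ W} (hΘ : Θ ∈ 𝔊) (hΘΘ : Θ * Θ = 1)
    {P Q : Submodule ℂ W} (hP : ∀ x, x ∈ P ↔ Θ x = x) (hQ : ∀ x, x ∈ Q ↔ Θ x = -x)
    (hP7 : Module.finrank ℂ P = 7) (hQ8 : 8 ≤ Module.finrank ℂ Q) (hQ7 : ¬ 7 ∣ Module.finrank ℂ Q)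
    {s : W → W → ℂ} (hadd : ∀ x y z, s (x + y) z = s x z + s y z)
    (hsmul : ∀ (c : ℂ) (x y : W), s (c • x) y = c * s x y) (hsymm : ∀ x y, s y x = starRingEnd ℂ (s x y))
    (hPQ : ∀ p ∈ P, ∀ q ∈ Q, s p q = 0) (hdefP : ∀ p ∈ P, s p p = 0 → p = 0) (hdefQ : ∀ q ∈ Q, s q q = 0 → q = 0)
    (hadj : ∀ X ∈ 𝔊, ∃ Y ∈ 𝔊, ∀ x y, s (X x) y = s x (Y y)) :
    ∃ B ∈ 𝔊, Θ * B = B ∧ B * Θ = -B ∧ ∀ p ∈ P, ∃ w, B w = p := by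
  classical
  have hraiseval : ∀ Z : Module.End ℂ W, Θ * Z = Z → ∀ w, Z w ∈ P := fun Z hΘZ w =>
    (hP _).2 (by rw [← Module.End.mul_apply, hΘZ])
  have hle : ∀ B' : Module.End ℂ W, Θ * B' = B' → Module.finrank ℂ (LinearMap.range B') ≤ 7 := fun B' h => by
    rw [← hP7]
    exact Submodule.finrank_mono (by rintro _ ⟨w, rfl⟩; exact hraiseval B' h w)
  have honto : ∀ B' : Module.End ℂ W, Θ * B' = B' → 7 ≤ Module.finrank ℂ (LinearMap.range B') →
      ∀ p ∈ P, ∃ w, B' w = p := by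
    intro B' hΘB' h7 p hp
    have hle' : LinearMap.range B' ≤ P := by rintro _ ⟨w, rfl⟩; exact hraiseval B' hΘB' w
    have heq : LinearMap.range B' = P := Submodule.eq_of_le_of_finrank_le hle' (by rw [hP7]; exact h7)
    have hp' : p ∈ LinearMap.range B' := heq ▸ hp
    exact hp'
  have hup : ∀ B' ∈ 𝔊, Θ * B' = B' → B' * Θ = -B' →
      2 ≤ Module.finrank ℂ (LinearMap.range B') → Module.finrank ℂ (LinearMap.range B') ≤ 6 →
      ∃ B'' ∈ 𝔊, Θ * B'' = B'' ∧ B'' * Θ = -B'' ∧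
        Module.finrank ℂ (LinearMap.range B') < Module.finrank ℂ (LinearMap.range B'') := by
    intro B' hB' hΘB' hB'Θ h2 h6
    by_cases hr6 : Module.finrank ℂ (LinearMap.range B') = 6
    · -- triple route: `m (7 − ρ) = 6 ρ` forces `dim Q ∈ {7, 14, 21}`
      refine UnitaryRaisingRank.exists_raise_rank_gt_of_finrank_eq_succ_of_smul hbr hirr hΘ hΘΘ hP hQ hB' hΘB' hB'Θ
        (by omega) (by rw [hr6, hP7]) (by omega) (fun ρ hρ1 hρr => ?_) hadd hsmul hsymm hPQ hdefP hdefQ hadj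
      rw [hr6] at hρr ⊢
      interval_cases ρ <;> omega
    · -- Ψ-core route with the cores `(5 | 2)`, `(4 | 3)`, `(3 | 4)`, `(2 | 5)`
      refine UnitaryRaisingRank.exists_raise_rank_gt_of_psi_core hbr hirr hΘ hΘΘ hP hQ hB' hΘB' hB'Θ (by omega)
        (by omega) (by omega) hadd hsymm hPQ hdefP hdefQ hadj fun U 𝔩 ι P' Q' hbr𝔩 hirr𝔩 hι hιι hP' hQ' hfinP' hfinQ'
          hP'Q' hdefP' hdefQ' hadj𝔩 => ?_
      by_cases hr2 : Module.finrank ℂ (LinearMap.range B') = 2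
      · exact UnitaryTwoOdd.eq_top' hbr𝔩 hirr𝔩 hι hιι hP' hQ' ⟨2, by omega⟩ (by rw [hfinQ', hr2])
          (s := fun x y : U => s (x : W) y) (fun x y z => by simp only [Submodule.coe_add, hadd])
          (fun x y => hsymm x y) hP'Q' hdefP' hdefQ' hadj𝔩
      by_cases hr3 : Module.finrank ℂ (LinearMap.range B') = 3
      · exact UnitaryThreeCoprime.eq_top' hbr𝔩 hirr𝔩 hι hιι hP' hQ' (by omega) (by rw [hfinQ', hr3])
          (s := fun x y : U => s (x : W) y) (fun x y z => by simp only [Submodule.coe_add, hadd])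
          (fun x y => hsymm x y) hP'Q' hdefP' hdefQ' hadj𝔩
      by_cases hr4 : Module.finrank ℂ (LinearMap.range B') = 4
      · exact UnitaryThreeCoprime.eq_top hbr𝔩 hirr𝔩 hι hιι hP' hQ' (by omega) (by rw [hfinQ', hr4]; omega)
          (s := fun x y : U => s (x : W) y) (fun x y z => by simp only [Submodule.coe_add, hadd])
          (fun x y => hsymm x y) hP'Q' hdefP' hdefQ' hadj𝔩
      · have hr5 : Module.finrank ℂ (LinearMap.range B') = 5 := by omega
        exact UnitaryTwoOdd.eq_top hbr𝔩 hirr𝔩 hι hιι hP' hQ' (by omega) (by rw [hfinQ', hr5]; exact ⟨2, rfl⟩)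
          (s := fun x y : U => s (x : W) y) (fun x y z => by simp only [Submodule.coe_add, hadd])
          (fun x y => hsymm x y) hP'Q' hdefP' hdefQ' hadj𝔩
  obtain ⟨B₂, hB₂, hΘB₂, hB₂Θ, hrk₂⟩ :=
    UnitaryThreeCoprime.exists_raise_rank_ge_two hbr hirr hΘ hΘΘ hP hQ (by omega) (by omega)
  have h₂ := hle B₂ hΘB₂
  by_cases h7 : 7 ≤ Module.finrank ℂ (LinearMap.range B₂)
  · exact ⟨B₂, hB₂, hΘB₂, hB₂Θ, honto B₂ hΘB₂ h7⟩
  obtain ⟨B₃, hB₃, hΘB₃, hB₃Θ, hrk₃⟩ := hup B₂ hB₂ hΘB₂ hB₂Θ hrk₂ (by omega)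
  have h₃ := hle B₃ hΘB₃
  by_cases h7' : 7 ≤ Module.finrank ℂ (LinearMap.range B₃)
  · exact ⟨B₃, hB₃, hΘB₃, hB₃Θ, honto B₃ hΘB₃ h7'⟩
  obtain ⟨B₄, hB₄, hΘB₄, hB₄Θ, hrk₄⟩ := hup B₃ hB₃ hΘB₃ hB₃Θ (by omega) (by omega)
  have h₄ := hle B₄ hΘB₄
  by_cases h7'' : 7 ≤ Module.finrank ℂ (LinearMap.range B₄)
  · exact ⟨B₄, hB₄, hΘB₄, hB₄Θ, honto B₄ hΘB₄ h7''⟩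
  obtain ⟨B₅, hB₅, hΘB₅, hB₅Θ, hrk₅⟩ := hup B₄ hB₄ hΘB₄ hB₄Θ (by omega) (by omega)
  have h₅ := hle B₅ hΘB₅
  by_cases h7''' : 7 ≤ Module.finrank ℂ (LinearMap.range B₅)
  · exact ⟨B₅, hB₅, hΘB₅, hB₅Θ, honto B₅ hΘB₅ h7'''⟩
  obtain ⟨B₆, hB₆, hΘB₆, hB₆Θ, hrk₆⟩ := hup B₅ hB₅ hΘB₅ hB₅Θ (by omega) (by omega)
  have h₆ := hle B₆ hΘB₆
  by_cases h7'''' : 7 ≤ Module.finrank ℂ (LinearMap.range B₆)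
  · exact ⟨B₆, hB₆, hΘB₆, hB₆Θ, honto B₆ hΘB₆ h7''''⟩
  obtain ⟨B₇, hB₇, hΘB₇, hB₇Θ, hrk₇⟩ := hup B₆ hB₆ hΘB₆ hB₆Θ (by omega) (by omega)
  have h₇ := hle B₇ hΘB₇
  exact ⟨B₇, hB₇, hΘB₇, hB₇Θ, honto B₇ hΘB₇ (by omega)⟩

end RankSeven

section MainSeven

variable {W : Type*} [AddCommGroup W] [Module ℂ W]

universe u in
/-- The induction behind `UnitarySeven.eq_top_of_smul` (strong induction on `b` with `7 ∤ b`; bases `b = 1, …, 6`; step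
`b → b − 7` by `UnitaryCoprimeStep.eq_top_of_onto_of_core`). [cite: Ribet1983, Thm. 3]
[cite: Gordon1997, §6 (proof of Thm. 6.3.3, pp. 18–19)] -/
private theorem UnitarySeven.eq_top_of_smul_aux (b : ℕ) :
    ∀ {W : Type u} [AddCommGroup W] [Module ℂ W] [FiniteDimensional ℂ W]
      {𝔊 : Submodule ℂ (Module.End ℂ W)},
      (∀ Y ∈ 𝔊, ∀ Z ∈ 𝔊, Y * Z - Z * Y ∈ 𝔊) →
      (∀ U : Submodule ℂ W, (∀ A ∈ 𝔊, ∀ u ∈ U, A u ∈ U) → U = ⊥ ∨ U = ⊤) →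
      ∀ {Θ : Module.End ℂ W}, Θ ∈ 𝔊 → Θ * Θ = 1 →
      ∀ {P Q : Submodule ℂ W}, (∀ x, x ∈ P ↔ Θ x = x) → (∀ x, x ∈ Q ↔ Θ x = -x) →
      Module.finrank ℂ P = 7 → Module.finrank ℂ Q = b → ¬ 7 ∣ b →
      ∀ {s : W → W → ℂ}, (∀ x y z, s (x + y) z = s x z + s y z) →
      (∀ (c : ℂ) (x y : W), s (c • x) y = c * s x y) →
      (∀ x y, s y x = starRingEnd ℂ (s x y)) →
      (∀ p ∈ P, ∀ q ∈ Q, s p q = 0) → (∀ p ∈ P, s p p = 0 → p = 0) → (∀ q ∈ Q, s q q = 0 → q = 0) →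
      (∀ X ∈ 𝔊, ∃ Y ∈ 𝔊, ∀ x y, s (X x) y = s x (Y y)) → 𝔊 = ⊤ := by
  induction b using Nat.strong_induction_on with
  | _ b ih =>
  intro W _ _ _ 𝔊 hbr hirr Θ hΘ hΘΘ P Q hP hQ hP7 hQb hb7 s hadd hsmul hsymm hPQ hdefP hdefQ hadj
  have hb0 : b ≠ 0 := fun h => hb7 (by rw [h]; exact dvd_zero 7)
  by_cases hb1 : b = 1
  · exact UnitaryThreeCoprime.eq_top_of_finrank_eq_one hbr hirr hΘ hΘΘ hP hQ (by omega) (by rw [hQb, hb1])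
  by_cases hb2 : b = 2
  · exact UnitaryTwoOdd.eq_top' hbr hirr hΘ hΘΘ hP hQ (by rw [hP7]; exact ⟨3, rfl⟩) (by rw [hQb, hb2]) hadd hsymm hPQ
      hdefP hdefQ hadj
  by_cases hb3 : b = 3
  · exact UnitaryThreeCoprime.eq_top' hbr hirr hΘ hΘΘ hP hQ (by rw [hP7]; decide) (by rw [hQb, hb3]) hadd hsymm hPQ
      hdefP hdefQ hadj
  by_cases hb4 : b = 4
  · exact UnitaryFourOdd.eq_top' hbr hirr hΘ hΘΘ hP hQ (by rw [hP7]; exact ⟨3, rfl⟩) (by rw [hQb, hb4]) hadd hsymm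
      hPQ hdefP hdefQ hadj
  by_cases hb5 : b = 5
  · exact UnitaryFive.eq_top' hbr hirr hΘ hΘΘ hP hQ (by rw [hP7]; decide) (by rw [hQb, hb5]) hadd hsymm hPQ hdefP
      hdefQ hadj
  by_cases hb6 : b = 6
  · exact UnitaryCoprimeStep.eq_top_seven_six hbr hirr hΘ hΘΘ hP hQ hP7 (by rw [hQb, hb6]) hadd hsymm hPQ hdefP
      hdefQ hadj
  have hb8 : 8 ≤ b := by omega
  refine UnitaryCoprimeStep.eq_top_of_onto_of_core hbr hirr hΘ hΘΘ hP hQ hP7 hQb (by norm_num) (by omega) hadd hsymm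
    hPQ hdefP hdefQ hadj ?_ ?_
  · exact UnitarySeven.exists_raise_onto_seven_of_smul hbr hirr hΘ hΘΘ hP hQ hP7 (by rw [hQb]; exact hb8)
      (by rw [hQb]; exact hb7) hadd hsmul hsymm hPQ hdefP hdefQ hadj
  · intro 𝔩 ι P' Q' hbr𝔩 hirr𝔩 hι hιι hP' hQ' hfinP' hfinQ' hP'Q' hdefP' hdefQ' hadj𝔩
    exact ih (b - 7) (by omega) hbr𝔩 hirr𝔩 hι hιι hP' hQ' hfinP' hfinQ' (fun h => hb7 (by omega))
      (s := fun x y : Q => s (x : W) y) (fun x y z => by simp only [Submodule.coe_add, hadd])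
      (fun c x y => by simp only [Submodule.coe_smul, hsmul]) (fun x y => hsymm x y) hP'Q' hdefP' hdefQ' hadj𝔩

/-- **THE `Θ`-SUBALGEBRA THEOREM FOR UNITARY MULTIPLICITIES `(7, b)`, EVERY `b` PRIME TO `7`** (Ribet's Thm. 3 at
`(7, n″)`, `7 ∤ n″`, classification-free; NEW beyond the tree's `(7, ≤ 6)`, `(7,13)`: `b = 8, 9, 10, 11, 12, 15, …`).
[cite: Ribet1983, Thm. 3] [cite: Gordon1997, Thm. 6.3 (3) and pp. 18–19] [cite: Deligne1982HodgeCycles, I §3 Prop. 3.4, 3.6] -/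
theorem UnitarySeven.eq_top_of_smul [FiniteDimensional ℂ W] {𝔊 : Submodule ℂ (Module.End ℂ W)}
    (hbr : ∀ Y ∈ 𝔊, ∀ Z ∈ 𝔊, Y * Z - Z * Y ∈ 𝔊)
    (hirr : ∀ U : Submodule ℂ W, (∀ A ∈ 𝔊, ∀ u ∈ U, A u ∈ U) → U = ⊥ ∨ U = ⊤)
    {Θ : Module.End ℂ W} (hΘ : Θ ∈ 𝔊) (hΘΘ : Θ * Θ = 1)
    {P Q : Submodule ℂ W} (hP : ∀ x, x ∈ P ↔ Θ x = x) (hQ : ∀ x, x ∈ Q ↔ Θ x = -x)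
    (hP7 : Module.finrank ℂ P = 7) (hQ7 : ¬ 7 ∣ Module.finrank ℂ Q)
    {s : W → W → ℂ} (hadd : ∀ x y z, s (x + y) z = s x z + s y z)
    (hsmul : ∀ (c : ℂ) (x y : W), s (c • x) y = c * s x y) (hsymm : ∀ x y, s y x = starRingEnd ℂ (s x y))
    (hPQ : ∀ p ∈ P, ∀ q ∈ Q, s p q = 0) (hdefP : ∀ p ∈ P, s p p = 0 → p = 0) (hdefQ : ∀ q ∈ Q, s q q = 0 → q = 0)
    (hadj : ∀ X ∈ 𝔊, ∃ Y ∈ 𝔊, ∀ x y, s (X x) y = s x (Y y)) : 𝔊 = ⊤ :=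
  UnitarySeven.eq_top_of_smul_aux _ hbr hirr hΘ hΘΘ hP hQ hP7 rfl hQ7 hadd hsmul hsymm hPQ hdefP hdefQ hadj

/-- **The mirror `(b | 7)`, `7 ∤ b`** (apply `eq_top_of_smul` to `−Θ`). [cite: Ribet1983, Thm. 3]
[cite: Gordon1997, Thm. 6.3 (3)] -/
theorem UnitarySeven.eq_top_of_smul' [FiniteDimensional ℂ W] {𝔊 : Submodule ℂ (Module.End ℂ W)}
    (hbr : ∀ Y ∈ 𝔊, ∀ Z ∈ 𝔊, Y * Z - Z * Y ∈ 𝔊)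
    (hirr : ∀ U : Submodule ℂ W, (∀ A ∈ 𝔊, ∀ u ∈ U, A u ∈ U) → U = ⊥ ∨ U = ⊤)
    {Θ : Module.End ℂ W} (hΘ : Θ ∈ 𝔊) (hΘΘ : Θ * Θ = 1)
    {P Q : Submodule ℂ W} (hP : ∀ x, x ∈ P ↔ Θ x = x) (hQ : ∀ x, x ∈ Q ↔ Θ x = -x)
    (hP7 : ¬ 7 ∣ Module.finrank ℂ P) (hQ7 : Module.finrank ℂ Q = 7)
    {s : W → W → ℂ} (hadd : ∀ x y z, s (x + y) z = s x z + s y z)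
    (hsmul : ∀ (c : ℂ) (x y : W), s (c • x) y = c * s x y) (hsymm : ∀ x y, s y x = starRingEnd ℂ (s x y))
    (hPQ : ∀ p ∈ P, ∀ q ∈ Q, s p q = 0) (hdefP : ∀ p ∈ P, s p p = 0 → p = 0) (hdefQ : ∀ q ∈ Q, s q q = 0 → q = 0)
    (hadj : ∀ X ∈ 𝔊, ∃ Y ∈ 𝔊, ∀ x y, s (X x) y = s x (Y y)) : 𝔊 = ⊤ := by
  have hnΘ : -Θ ∈ 𝔊 := Submodule.neg_mem _ hΘ
  have hnΘΘ : (-Θ) * (-Θ) = 1 := by rw [neg_mul_neg, hΘΘ]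
  exact UnitarySeven.eq_top_of_smul hbr hirr hnΘ hnΘΘ (P := Q) (Q := P)
    (fun x => by rw [hQ, LinearMap.neg_apply, neg_eq_iff_eq_neg]) (fun x => by rw [hP, LinearMap.neg_apply, neg_inj])
    hQ7 hP7 hadd hsmul hsymm (fun q hq p hp => by rw [hsymm, hPQ p hp q hq, map_zero]) hdefQ hdefP hadj

end MainSeven

end HodgeStructure

end Literature.AlgebraicGeometry.Motives

end
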